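import Mathlib
import HarnessLib
import Summits.Ventures.LatticeQCDFlow.Exactness.KickedProductTwoPoint
import Summits.Ventures.LatticeQCDFlow.Exactness.SUNProductTrajectory

/-!
# Multi-step leapfrog HMC on `SU(N)`: the short-trajectory threshold of the coordinates

HONEST FRAMING: exact (Metropolis-corrected) sampling algorithms for lattice gauge theory;
figures of merit are autocorrelation/cost numbers at stated couplings and volumes; no
continuum-physics claim.

Venture `LatticeQCDFlow` (cell pub-lqcd), topic `Exactness`, FANOUT row 9 (eng-latcore, the
engine `latflow.core.hmc.HMC(f, β, 'leapfrog').trajectory(τ, nstep)` / `sun_2d.HMC2D` on `SU(N)`,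
`nstep ≥ 2`).  NEW WORK of the cell over Mathlib (`hasStrictFDerivAt_exp_zero`,
`HasStrictFDerivAt.approximates_deriv_on_nhds`) and the tree (`SUNProductTrajectory.lean`:
`hasStrictFDerivAt_matrixLog_one`, `linkExp`, `linkLog`, `sunJ`, `sunCoordOf`, `suChartSet`;
`KickedProductTwoPoint.lean`: `plfSmall`); nothing here is cited as a fact.

THE POINT.  The ergodicity argument of `SUNMultiStepLeapfrogHMCErgodic.lean` needs four smallness
conditions (drift angles inside the exponential's defect radius, `plfSmall` small against the
distortion `‖coordOf‖‖ι‖`, trajectories inside the logarithm's chart radius, pure-kick displacement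
small against the trajectory length); here they follow from ONE positive number
`sunShortTrajThreshold ι hinj` of the coordinates — NOT of the lattice — via `nε ≤ s`, `(2n+1)b ≤ s`,
`K_g·ε·n² ≤ s`:

* §1 per-matrix defects `exists_matrixExp_defect` / `exists_matrixLog_defect_chart` and their lifts to
  any link set (`linkExp_defect_of_matrix`, `linkLog_defect_of_matrix`); `norm_sunJ_le` (`‖sunJ ι‖ ≤ ‖ι‖`),
  `norm_sunCoordOf_le` (`‖sunCoordOf‖ ≤ ‖coordOf‖`).
* §2 `sunExpRadius`, `sunLogRadius` (chosen radii, by choice from §1 at the defects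
  `η = 1/(108·N·(‖coordOf‖‖ι‖ + 1))`, `η_L = 1/(12(‖coordOf‖‖ι‖ + 1))`), **`sunShortTrajThreshold`** and
  `sunShortTrajThreshold_pos`; **`sunShortTraj_package`** — the four conditions on any link set.

NOT CLAIMED: any value of the threshold (inverse function theorem: the radii are not computed).
-/

noncomputable section

namespace Summit.Ventures.LatticeQCDFlow.Exactness

open NormedSpace Set Filter Topology Metric Function
open scoped Matrix Matrix.Norms.Operator NNReal

set_option backward.isDefEq.respectTransparency false

variable {n : Type*} [Fintype n] [DecidableEq n]

/-! ## §1 Per-matrix defects, lifted to any link set; norms of the coordinate maps -/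

section Defects

/-- **The exponential defect on `M_N(ℂ)`**: for `η > 0` a radius `ρ > 0` with
`‖exp a − exp a' − (a − a')‖ ≤ η‖a − a'‖` for `‖a‖, ‖a'‖ ≤ ρ`. -/
theorem exists_matrixExp_defect {η : ℝ} (hη : 0 < η) :
    ∃ ρ : ℝ, 0 < ρ ∧ ∀ a a' : Matrix n n ℂ, ‖a‖ ≤ ρ → ‖a'‖ ≤ ρ → ‖exp a - exp a' - (a - a')‖ ≤ η * ‖a - a'‖ := by
  have hc : (0 : ℝ≥0) < ⟨η, hη.le⟩ := by rw [← NNReal.coe_lt_coe]; exact hη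
  obtain ⟨s, hs, happ⟩ := (hasStrictFDerivAt_exp_zero (𝕂 := ℝ) (𝔸 := Matrix n n ℂ)).approximates_deriv_on_nhds
    (c := ⟨η, hη.le⟩) (Or.inr hc)
  obtain ⟨ρ₀, hρ₀, hball⟩ := Metric.mem_nhds_iff.1 hs
  exact ⟨ρ₀ / 2, half_pos hρ₀, fun a a' ha ha' =>
    happ a (hball (mem_ball_zero_iff.2 (by linarith))) a' (hball (mem_ball_zero_iff.2 (by linarith)))⟩

/-- **The logarithm defect on `M_N(ℂ)` and the chart**: for `η > 0` a radius `ρ > 0` with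
`‖log U − log U' − (U − U')‖ ≤ η‖U − U'‖` for `‖U − 1‖, ‖U' − 1‖ ≤ ρ`, every special unitary `U` with
`‖U − 1‖ ≤ ρ` lying in `suChartSet`. -/
theorem exists_matrixLog_defect_chart {η : ℝ} (hη : 0 < η) :
    ∃ ρ : ℝ, 0 < ρ ∧
      (∀ U U' : Matrix n n ℂ, ‖U - 1‖ ≤ ρ → ‖U' - 1‖ ≤ ρ → ‖matrixLog U - matrixLog U' - (U - U')‖ ≤ η * ‖U - U'‖) ∧
      ∀ U : Matrix.specialUnitaryGroup n ℂ, ‖(U : Matrix n n ℂ) - 1‖ ≤ ρ → U ∈ suChartSet (n := n) := by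
  have hc : (0 : ℝ≥0) < ⟨η, hη.le⟩ := by rw [← NNReal.coe_lt_coe]; exact hη
  obtain ⟨s, hs, happ⟩ := (hasStrictFDerivAt_matrixLog_one (n := n)).approximates_deriv_on_nhds
    (c := ⟨η, hη.le⟩) (Or.inr hc)
  obtain ⟨ρ₀, hρ₀, hball⟩ := Metric.mem_nhds_iff.1 hs
  obtain ⟨ρ₁, hρ₁, hball₁⟩ := Metric.mem_nhds_iff.1 (isOpen_suChartSet.mem_nhds (one_mem_suChartSet (n := n)))
  refine ⟨min (ρ₀ / 2) (ρ₁ / 2), lt_min (half_pos hρ₀) (half_pos hρ₁), fun U U' hU hU' => ?_, fun U hU => ?_⟩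
  · have hmem : ∀ B : Matrix n n ℂ, ‖B - 1‖ ≤ min (ρ₀ / 2) (ρ₁ / 2) → B ∈ s := fun B hB =>
      hball (mem_ball.2 (by rw [dist_eq_norm]; linarith [min_le_left (ρ₀ / 2) (ρ₁ / 2)]))
    exact happ U (hmem U hU) U' (hmem U' hU')
  · refine hball₁ (mem_ball.2 ?_)
    calc dist U 1 = ‖(U : Matrix n n ℂ) - 1‖ := by rw [Subtype.dist_eq, dist_eq_norm]; rfl
      _ ≤ min (ρ₀ / 2) (ρ₁ / 2) := hU
      _ < ρ₁ := by linarith [min_le_right (ρ₀ / 2) (ρ₁ / 2)]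

variable {L : Type*} [Fintype L]

/-- A per-matrix exponential defect lifts to any link set (sup norms). -/
theorem linkExp_defect_of_matrix {η ρ : ℝ} (hη : 0 ≤ η)
    (h : ∀ a a' : Matrix n n ℂ, ‖a‖ ≤ ρ → ‖a'‖ ≤ ρ → ‖exp a - exp a' - (a - a')‖ ≤ η * ‖a - a'‖)
    (a a' : L → Matrix n n ℂ) (ha : ‖a‖ ≤ ρ) (ha' : ‖a'‖ ≤ ρ) :
    ‖linkExp a - linkExp a' - (a - a')‖ ≤ η * ‖a - a'‖ := by
  refine (pi_norm_le_iff_of_nonneg (by positivity)).2 fun l => ?_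
  have hl := h (a l) (a' l) ((norm_le_pi_norm a l).trans ha) ((norm_le_pi_norm a' l).trans ha')
  simp only [Pi.sub_apply, linkExp_apply]
  exact hl.trans (mul_le_mul_of_nonneg_left (norm_le_pi_norm (a - a') l) hη)

/-- A per-matrix logarithm defect lifts to any link set (sup norms). -/
theorem linkLog_defect_of_matrix {η ρ : ℝ} (hη : 0 ≤ η)
    (h : ∀ U U' : Matrix n n ℂ, ‖U - 1‖ ≤ ρ → ‖U' - 1‖ ≤ ρ → ‖matrixLog U - matrixLog U' - (U - U')‖ ≤ η * ‖U - U'‖)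
    (W W' : L → Matrix n n ℂ) (hW : ‖W - 1‖ ≤ ρ) (hW' : ‖W' - 1‖ ≤ ρ) :
    ‖linkLog W - linkLog W' - (W - W')‖ ≤ η * ‖W - W'‖ := by
  refine (pi_norm_le_iff_of_nonneg (by positivity)).2 fun l => ?_
  have h1 : ∀ B : L → Matrix n n ℂ, ‖B - 1‖ ≤ ρ → ‖B l - 1‖ ≤ ρ := fun B hB =>
    calc ‖B l - 1‖ = ‖(B - 1) l‖ := by simp
      _ ≤ ‖B - 1‖ := norm_le_pi_norm _ l
      _ ≤ ρ := hB
  have hl := h (W l) (W' l) (h1 W hW) (h1 W' hW')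
  simp only [Pi.sub_apply, linkLog_apply]
  exact hl.trans (mul_le_mul_of_nonneg_left (norm_le_pi_norm (W - W') l) hη)

variable {E : Type*} [NormedAddCommGroup E] [NormedSpace ℝ E] [FiniteDimensional ℝ E] (ι : E →ₗ[ℝ] Matrix n n ℂ)

omit [DecidableEq n] in
/-- `‖sunJ ι‖ ≤ ‖ι‖` (sup norms over links). -/
theorem norm_sunJ_le : ‖sunJ (L := L) ι‖ ≤ ‖LinearMap.toContinuousLinearMap ι‖ := by
  refine ContinuousLinearMap.opNorm_le_bound _ (norm_nonneg _) fun p => ?_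
  refine (pi_norm_le_iff_of_nonneg (by positivity)).2 fun l => ?_
  rw [sunJ_apply]
  exact ((LinearMap.toContinuousLinearMap ι).le_opNorm (p l)).trans
    (mul_le_mul_of_nonneg_left (norm_le_pi_norm p l) (norm_nonneg _))

variable (hinj : Injective ι)

omit [DecidableEq n] [FiniteDimensional ℝ E] in
/-- `‖sunCoordOf ι‖ ≤ ‖coordOf ι‖` (sup norms over links). -/
theorem norm_sunCoordOf_le : ‖sunCoordOf (L := L) ι hinj‖ ≤ ‖LinearMap.toContinuousLinearMap (coordOf ι hinj)‖ := by
  refine ContinuousLinearMap.opNorm_le_bound _ (norm_nonneg _) fun W => ?_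
  refine (pi_norm_le_iff_of_nonneg (by positivity)).2 fun l => ?_
  rw [sunCoordOf_apply]
  exact ((LinearMap.toContinuousLinearMap (coordOf ι hinj)).le_opNorm (W l)).trans
    (mul_le_mul_of_nonneg_left (norm_le_pi_norm W l) (norm_nonneg _))

end Defects

/-! ## §2 The threshold -/

section Threshold

variable {E : Type*} [NormedAddCommGroup E] [NormedSpace ℝ E] [FiniteDimensional ℝ E]
  (ι : E →ₗ[ℝ] Matrix n n ℂ) (hinj : Injective ι)

/-- The distortion of the coordinates: `D = ‖coordOf‖·‖ι‖ + 1 ≥ 1`. -/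
def sunCoordDistortion : ℝ :=
  ‖LinearMap.toContinuousLinearMap (coordOf ι hinj)‖ * ‖LinearMap.toContinuousLinearMap ι‖ + 1

omit [DecidableEq n] in
/-- `1 ≤ D`. -/
theorem one_le_sunCoordDistortion : 1 ≤ sunCoordDistortion ι hinj := by
  unfold sunCoordDistortion; nlinarith [norm_nonneg (LinearMap.toContinuousLinearMap (coordOf ι hinj)),
    norm_nonneg (LinearMap.toContinuousLinearMap ι)]

/-- The exponential defect used: `η = 1/(108·N·D)`. -/
def sunExpDefect : ℝ := 1 / (108 * Fintype.card n * sunCoordDistortion ι hinj)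

/-- The logarithm defect used: `η_L = 1/(12 D)`. -/
def sunLogDefect : ℝ := 1 / (12 * sunCoordDistortion ι hinj)

variable [Nonempty n]

omit [DecidableEq n] in
/-- `0 < η`. -/
theorem sunExpDefect_pos : 0 < sunExpDefect (n := n) ι hinj := by
  unfold sunExpDefect
  have := one_le_sunCoordDistortion ι hinj
  have : (0 : ℝ) < Fintype.card n := by exact_mod_cast Fintype.card_pos
  positivity

omit [Nonempty n] [DecidableEq n] in
/-- `0 < η_L`. -/
theorem sunLogDefect_pos : 0 < sunLogDefect ι hinj := by
  unfold sunLogDefect; have := one_le_sunCoordDistortion ι hinj; positivity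

/-- **The exponential radius** (chosen at defect `η`). -/
def sunExpRadius : ℝ := Classical.choose (exists_matrixExp_defect (n := n) (sunExpDefect_pos ι hinj))

/-- Its defining property. -/
theorem sunExpRadius_spec : 0 < sunExpRadius (n := n) ι hinj ∧ ∀ a a' : Matrix n n ℂ,
    ‖a‖ ≤ sunExpRadius ι hinj → ‖a'‖ ≤ sunExpRadius ι hinj →
      ‖exp a - exp a' - (a - a')‖ ≤ sunExpDefect ι hinj * ‖a - a'‖ :=
  Classical.choose_spec (exists_matrixExp_defect (n := n) (sunExpDefect_pos ι hinj))

/-- **The logarithm radius** (chosen at defect `η_L`, inside the chart). -/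
def sunLogRadius : ℝ := Classical.choose (exists_matrixLog_defect_chart (n := n) (sunLogDefect_pos ι hinj))

omit [Nonempty n] in
/-- Its defining property. -/
theorem sunLogRadius_spec : 0 < sunLogRadius (n := n) ι hinj ∧
    (∀ U U' : Matrix n n ℂ, ‖U - 1‖ ≤ sunLogRadius ι hinj → ‖U' - 1‖ ≤ sunLogRadius ι hinj →
      ‖matrixLog U - matrixLog U' - (U - U')‖ ≤ sunLogDefect ι hinj * ‖U - U'‖) ∧
    ∀ U : Matrix.specialUnitaryGroup n ℂ, ‖(U : Matrix n n ℂ) - 1‖ ≤ sunLogRadius ι hinj → U ∈ suChartSet (n := n) :=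
  Classical.choose_spec (exists_matrixLog_defect_chart (n := n) (sunLogDefect_pos ι hinj))

/-- **THE SHORT-TRAJECTORY THRESHOLD OF THE COORDINATES** `s(ι) > 0`: with `a = ‖ι‖`, `N` the matrix
size, `D` the distortion, `ρ`, `ρ_L` the two radii,
`s = min 1 (min (ρ/(2a+1)) (min (1/(108 D (1+2N)(2a+1))) (min (ρ_L/(2N(2a+1))) (min (1/(216 D (Na+1))) (1/(12 D N + 1))))))`. -/
def sunShortTrajThreshold : ℝ :=
  min 1 (min (sunExpRadius ι hinj / (2 * ‖LinearMap.toContinuousLinearMap ι‖ + 1))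
    (min (1 / (108 * sunCoordDistortion ι hinj * (1 + 2 * Fintype.card n) * (2 * ‖LinearMap.toContinuousLinearMap ι‖ + 1)))
    (min (sunLogRadius ι hinj / (2 * Fintype.card n * (2 * ‖LinearMap.toContinuousLinearMap ι‖ + 1)))
    (min (1 / (216 * sunCoordDistortion ι hinj * (Fintype.card n * ‖LinearMap.toContinuousLinearMap ι‖ + 1)))
      (1 / (12 * sunCoordDistortion ι hinj * Fintype.card n + 1))))))

/-- `0 < s(ι)`. -/
theorem sunShortTrajThreshold_pos : 0 < sunShortTrajThreshold (n := n) ι hinj := by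
  have hD := one_le_sunCoordDistortion ι hinj
  have hρ := (sunExpRadius_spec (n := n) ι hinj).1
  have hρL := (sunLogRadius_spec (n := n) ι hinj).1
  have hN : (0 : ℝ) < Fintype.card n := by exact_mod_cast Fintype.card_pos
  have ha := norm_nonneg (LinearMap.toContinuousLinearMap ι)
  unfold sunShortTrajThreshold; positivity

/-- `s(ι) ≤ 1`. -/
theorem sunShortTrajThreshold_le_one : sunShortTrajThreshold (n := n) ι hinj ≤ 1 := min_le_left _ _

end Threshold

/-! ## §3 The four smallness conditions on any link set -/

section Arith

/-- Arithmetic: if `t ≤ s ≤ c / d` with `0 < d`, then `d * t ≤ c`. -/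
theorem mul_le_of_le_div {t s c d : ℝ} (ht : t ≤ s) (hs : s ≤ c / d) (hd : 0 < d) : d * t ≤ c := by
  have := (le_div_iff₀ hd).1 (ht.trans hs)
  linarith [mul_comm t d]

/-- Arithmetic: the total angle `τ j (1 + b') ≤ 2 a s`. -/
theorem st_arith_theta {τ j a b' s : ℝ} (hτ0 : 0 ≤ τ) (hτ : τ ≤ s) (hj0 : 0 ≤ j) (hj : j ≤ a) (hb0 : 0 ≤ b')
    (hb : b' ≤ s) (hs1 : s ≤ 1) : τ * j * (1 + b') ≤ 2 * a * s := by
  have h3 : τ * j * (1 + b') ≤ (s * a) * 2 :=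
    mul_le_mul (mul_le_mul hτ hj hj0 (hτ0.trans hτ)) (by linarith) (by linarith) (mul_nonneg (hτ0.trans hτ) (hj0.trans hj))
  linarith

/-- Arithmetic: the pure-kick angle `τ j b' ≤ τ a s`. -/
theorem st_arith_theta0 {τ j a b' s : ℝ} (hτ0 : 0 ≤ τ) (hj0 : 0 ≤ j) (hj : j ≤ a) (hb0 : 0 ≤ b') (hb : b' ≤ s) :
    τ * j * b' ≤ τ * a * s := by
  have h1 : j * b' ≤ a * s := mul_le_mul hj hb hb0 (hj0.trans hj)
  have := mul_le_mul_of_nonneg_left h1 hτ0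
  linarith [mul_assoc τ j b', mul_assoc τ a s]

/-- Arithmetic of (T3): `2ΘC ≤ ρ_L`. -/
theorem st_arith_T3 {Θ a s ρL C : ℝ} (hΘ : Θ ≤ 2 * a * s) (hs0 : 0 ≤ s) (hC : 0 ≤ C)
    (h : (2 * C * (2 * a + 1)) * s ≤ ρL) : 2 * Θ * C ≤ ρL := by
  have h1 : 2 * Θ * C ≤ 2 * (2 * a * s) * C := by nlinarith
  nlinarith

/-- Arithmetic of (T2): `plfSmall ≤ 1/(6D)`. -/
theorem st_arith_S {Θ a s C D κ j η : ℝ} (hΘ : Θ ≤ 2 * a * s) (hs0 : 0 ≤ s) (hC1 : 1 ≤ C)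
    (hD1 : 1 ≤ D) (hκ : κ ≤ s) (hj0 : 0 ≤ j) (hj : j ≤ a) (hη : η = 1 / (108 * C * D))
    (hsS : (108 * D * (1 + 2 * C) * (2 * a + 1)) * s ≤ 1) (hsK : (216 * D * (C * a + 1)) * s ≤ 1) :
    6 * Θ * (1 + 2 * C) + 6 * η * C + 12 * (κ * C * j) ≤ 1 / (6 * D) := by
  have hD0 : 0 < D := by linarith
  have hC0 : 0 < C := by linarith
  have hDs : 0 ≤ D * s := mul_nonneg hD0.le hs0
  have hCDs : 0 ≤ C * D * s := mul_nonneg (mul_nonneg hC0.le hD0.le) hs0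
  have p1 : 6 * Θ * (1 + 2 * C) ≤ 1 / (18 * D) := by
    rw [le_div_iff₀ (by positivity)]
    have e1 : 6 * Θ * (1 + 2 * C) * (18 * D) ≤ 6 * (2 * a * s) * (1 + 2 * C) * (18 * D) := by
      have : 6 * Θ * (1 + 2 * C) ≤ 6 * (2 * a * s) * (1 + 2 * C) :=
        mul_le_mul_of_nonneg_right (by linarith) (by linarith)
      exact mul_le_mul_of_nonneg_right this (by positivity)
    have e2 : 6 * (2 * a * s) * (1 + 2 * C) * (18 * D) ≤ 108 * D * (1 + 2 * C) * (2 * a + 1) * s := by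
      nlinarith [hDs, hCDs]
    linarith
  have p2 : 6 * η * C = 1 / (18 * D) := by rw [hη]; field_simp; ring
  have p3 : 12 * (κ * C * j) ≤ 1 / (18 * D) := by
    rw [le_div_iff₀ (by positivity)]
    have e1 : κ * C * j ≤ s * C * a := by
      have h1 : κ * C ≤ s * C := mul_le_mul_of_nonneg_right hκ hC0.le
      exact mul_le_mul h1 hj hj0 (by positivity)
    have e2 : 12 * (κ * C * j) * (18 * D) ≤ 12 * (s * C * a) * (18 * D) :=
      mul_le_mul_of_nonneg_right (by linarith) (by positivity)
    have e3 : 12 * (s * C * a) * (18 * D) ≤ 216 * D * (C * a + 1) * s := by nlinarith [hDs]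
    linarith
  have e : 1 / (18 * D) + 1 / (18 * D) + 1 / (18 * D) = 1 / (6 * D) := by field_simp; ring
  linarith

/-- Arithmetic of (T2b): `c(2η_L + S)j ≤ 1/3`. -/
theorem st_arith_T2b {c c₀ a j S D : ℝ} (hc0 : 0 ≤ c) (hc : c ≤ c₀) (hj0 : 0 ≤ j) (hj : j ≤ a)
    (hS0 : 0 ≤ S) (hS : S ≤ 1 / (6 * D)) (hD : D = c₀ * a + 1) :
    c * (2 * (1 / (12 * D)) + S) * j ≤ 1 / 3 := by
  have hc₀ : 0 ≤ c₀ := hc0.trans hc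
  have ha : 0 ≤ a := hj0.trans hj
  have hca : 0 ≤ c₀ * a := mul_nonneg hc₀ ha
  have hD0 : 0 < D := by rw [hD]; linarith
  have e1 : c * (2 * (1 / (12 * D)) + S) * j ≤ c₀ * (2 * (1 / (12 * D)) + 1 / (6 * D)) * a :=
    mul_le_mul (mul_le_mul hc (by linarith) (by positivity) hc₀) hj hj0 (by positivity)
  refine e1.trans ?_
  rw [show c₀ * (2 * (1 / (12 * D)) + 1 / (6 * D)) * a = (c₀ * a) / (3 * D) by field_simp; ring,
    div_le_div_iff₀ (by positivity) (by norm_num), hD]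
  nlinarith

/-- Arithmetic of (T4): `c·4Θ₀C ≤ τ/3`. -/
theorem st_arith_T4 {c c₀ a τ Θ₀ s C D : ℝ} (hc0 : 0 ≤ c) (hc : c ≤ c₀) (hτ0 : 0 ≤ τ) (ha : 0 ≤ a)
    (hΘ₀0 : 0 ≤ Θ₀) (hΘ₀ : Θ₀ ≤ τ * a * s) (hs0 : 0 ≤ s) (hC1 : 1 ≤ C) (hD : D = c₀ * a + 1)
    (hsc : (12 * D * C + 1) * s ≤ 1) : c * (4 * Θ₀ * C) ≤ τ / 3 := by
  have hc₀ : 0 ≤ c₀ := hc0.trans hc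
  have hC0 : 0 ≤ C := zero_le_one.trans hC1
  have e0 : 4 * Θ₀ * C ≤ 4 * (τ * a * s) * C :=
    mul_le_mul_of_nonneg_right (mul_le_mul_of_nonneg_left hΘ₀ (by norm_num)) hC0
  have e1 : c * (4 * Θ₀ * C) ≤ c₀ * (4 * (τ * a * s) * C) :=
    mul_le_mul hc e0 (by positivity) hc₀
  refine e1.trans ?_
  have e2 : c₀ * a ≤ D := by rw [hD]; linarith
  have e3 : c₀ * (4 * (τ * a * s) * C) = τ * (4 * (c₀ * a) * C * s) := by ring
  rw [e3]
  have f1 : (c₀ * a) * (C * s) ≤ D * (C * s) := mul_le_mul_of_nonneg_right e2 (by positivity)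
  have hD0 : 0 ≤ D := by rw [hD]; positivity
  have f2 : 0 ≤ D * C * s := by positivity
  have e4 : 4 * (c₀ * a) * C * s ≤ 1 / 3 := by nlinarith [f1, f2]
  have := mul_le_mul_of_nonneg_left e4 hτ0
  linarith

end Arith

section Package

variable {E : Type*} [NormedAddCommGroup E] [NormedSpace ℝ E] [FiniteDimensional ℝ E]
  (ι : E →ₗ[ℝ] Matrix n n ℂ) (hinj : Injective ι) [Nonempty n]
variable {L : Type*} [Fintype L]

/-- **THE PACKAGE.**  On any link set, for `n ≥ 1`, `ε > 0`, `b, K_g ≥ 0` with `nε ≤ s(ι)`,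
`(2n+1)b ≤ s(ι)`, `K_g·ε·n² ≤ s(ι)`:
(T1) the total angle `Θ₁ = nε‖J‖(1 + (2n+1)b)` is within the exponential radius;
(T2) `plfSmall ≤ 1` at `C = N`, `K = K_g·N`, `η = sunExpDefect`, `R = 1`, and
`‖sunCoordOf‖(2η_L + plfSmall)‖J‖ ≤ 1/3`;
(T3) `2Θ₁N ≤ ρ_L`; (T4) `‖sunCoordOf‖·4Θ₀N ≤ nε/3`, `Θ₀ = nε‖J‖(2n+1)b`. -/
theorem sunShortTraj_package {N : ℕ} {ε b Kg : ℝ} (hN : 1 ≤ N) (hε : 0 < ε) (hb : 0 ≤ b) (hKg : 0 ≤ Kg)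
    (h1 : N * ε ≤ sunShortTrajThreshold ι hinj) (h2 : (2 * N + 1) * b ≤ sunShortTrajThreshold ι hinj)
    (h3 : Kg * ε * (N : ℝ) ^ 2 ≤ sunShortTrajThreshold ι hinj) :
    N * (ε * ‖sunJ (L := L) ι‖ * (1 + (2 * N + 1) * b)) ≤ sunExpRadius ι hinj ∧
    plfSmall (sunJ (L := L) ι) (Fintype.card n) (Kg * Fintype.card n) (sunExpDefect ι hinj) ε b 1 N ≤ 1 ∧
    ‖sunCoordOf (L := L) ι hinj‖ * (2 * sunLogDefect ι hinj +
        plfSmall (sunJ (L := L) ι) (Fintype.card n) (Kg * Fintype.card n) (sunExpDefect ι hinj) ε b 1 N) *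
      ‖sunJ (L := L) ι‖ ≤ 1 / 3 ∧
    2 * (N * (ε * ‖sunJ (L := L) ι‖ * (1 + (2 * N + 1) * b))) * Fintype.card n ≤ sunLogRadius ι hinj ∧
    ‖sunCoordOf (L := L) ι hinj‖ * (4 * (N * (ε * ‖sunJ (L := L) ι‖ * (0 + (2 * N + 1) * b))) * Fintype.card n) ≤ N * ε / 3 := by
  have hD1 : 1 ≤ sunCoordDistortion ι hinj := one_le_sunCoordDistortion ι hinj
  have hDdef : sunCoordDistortion ι hinj =
      ‖LinearMap.toContinuousLinearMap (coordOf ι hinj)‖ * ‖LinearMap.toContinuousLinearMap ι‖ + 1 := rfl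
  have hC1 : (1 : ℝ) ≤ Fintype.card n := by exact_mod_cast Fintype.card_pos
  have ha0 : 0 ≤ ‖LinearMap.toContinuousLinearMap ι‖ := norm_nonneg _
  have hj0 : 0 ≤ ‖sunJ (L := L) ι‖ := norm_nonneg _
  have hc0 : 0 ≤ ‖sunCoordOf (L := L) ι hinj‖ := norm_nonneg _
  have hja := norm_sunJ_le (L := L) ι
  have hcc := norm_sunCoordOf_le (L := L) ι hinj
  have hs0 : 0 < sunShortTrajThreshold ι hinj := sunShortTrajThreshold_pos ι hinj
  have hs1 : sunShortTrajThreshold ι hinj ≤ 1 := sunShortTrajThreshold_le_one ι hinj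
  have hN1 : (1 : ℝ) ≤ N := by exact_mod_cast hN
  have hτ0 : 0 ≤ (N : ℝ) * ε := by positivity
  have hb'0 : 0 ≤ (2 * (N : ℝ) + 1) * b := by positivity
  -- the five components of the threshold, multiplied out
  have hsρ : (2 * ‖LinearMap.toContinuousLinearMap ι‖ + 1) * sunShortTrajThreshold ι hinj ≤ sunExpRadius ι hinj :=
    mul_le_of_le_div le_rfl ((min_le_right _ _).trans (min_le_left _ _)) (by positivity)
  have hsS : (108 * sunCoordDistortion ι hinj * (1 + 2 * Fintype.card n) * (2 * ‖LinearMap.toContinuousLinearMap ι‖ + 1)) *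
      sunShortTrajThreshold ι hinj ≤ 1 :=
    mul_le_of_le_div le_rfl ((min_le_right _ _).trans ((min_le_right _ _).trans (min_le_left _ _))) (by positivity)
  have hsL : (2 * Fintype.card n * (2 * ‖LinearMap.toContinuousLinearMap ι‖ + 1)) * sunShortTrajThreshold ι hinj ≤
      sunLogRadius ι hinj :=
    mul_le_of_le_div le_rfl ((min_le_right _ _).trans ((min_le_right _ _).trans ((min_le_right _ _).trans (min_le_left _ _))))
      (by positivity)
  have hsK : (216 * sunCoordDistortion ι hinj * (Fintype.card n * ‖LinearMap.toContinuousLinearMap ι‖ + 1)) *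
      sunShortTrajThreshold ι hinj ≤ 1 :=
    mul_le_of_le_div le_rfl ((min_le_right _ _).trans ((min_le_right _ _).trans ((min_le_right _ _).trans
      ((min_le_right _ _).trans (min_le_left _ _))))) (by positivity)
  have hsc : (12 * sunCoordDistortion ι hinj * Fintype.card n + 1) * sunShortTrajThreshold ι hinj ≤ 1 :=
    mul_le_of_le_div le_rfl ((min_le_right _ _).trans ((min_le_right _ _).trans ((min_le_right _ _).trans
      ((min_le_right _ _).trans (min_le_right _ _))))) (by positivity)
  -- the two angles
  have hΘ1 : N * (ε * ‖sunJ (L := L) ι‖ * (1 + (2 * N + 1) * b)) ≤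
      2 * ‖LinearMap.toContinuousLinearMap ι‖ * sunShortTrajThreshold ι hinj := by
    have e := st_arith_theta hτ0 h1 hj0 hja hb'0 h2 hs1
    refine le_trans (le_of_eq (by ring)) e
  have hΘ0 : N * (ε * ‖sunJ (L := L) ι‖ * (0 + (2 * N + 1) * b)) ≤
      (N * ε) * ‖LinearMap.toContinuousLinearMap ι‖ * sunShortTrajThreshold ι hinj := by
    have e := st_arith_theta0 hτ0 hj0 hja hb'0 h2
    refine le_trans (le_of_eq (by ring)) e
  -- (T2)
  have hSval : plfSmall (sunJ (L := L) ι) (Fintype.card n) (Kg * Fintype.card n) (sunExpDefect ι hinj) ε b 1 N =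
      6 * (N * (ε * ‖sunJ (L := L) ι‖ * (1 + (2 * N + 1) * b))) * (1 + 2 * Fintype.card n) +
        6 * sunExpDefect ι hinj * Fintype.card n + 12 * ((Kg * ε * (N : ℝ) ^ 2) * Fintype.card n * ‖sunJ (L := L) ι‖) := by
    simp only [plfSmall]; ring
  have hS6 : plfSmall (sunJ (L := L) ι) (Fintype.card n) (Kg * Fintype.card n) (sunExpDefect ι hinj) ε b 1 N ≤
      1 / (6 * sunCoordDistortion ι hinj) := by
    rw [hSval]
    exact st_arith_S hΘ1 hs0.le hC1 hD1 h3 hj0 hja rfl hsS hsK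
  have hS0 : 0 ≤ plfSmall (sunJ (L := L) ι) (Fintype.card n) (Kg * Fintype.card n) (sunExpDefect ι hinj) ε b 1 N := by
    rw [hSval]; have := (sunExpDefect_pos ι hinj).le; positivity
  refine ⟨hΘ1.trans (by nlinarith), hS6.trans ?_, ?_, st_arith_T3 hΘ1 hs0.le (by positivity) hsL,
    st_arith_T4 hc0 hcc hτ0 ha0 (by positivity) hΘ0 hs0.le hC1 hDdef hsc⟩
  · rw [div_le_one (by positivity)]; linarith
  · exact st_arith_T2b hc0 hcc hj0 hja hS0 hS6 hDdef

end Package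

end Summit.Ventures.LatticeQCDFlow.Exactness
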